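import Mathlib.Data.NNReal.Basic
import Mathlib.Algebra.Group.Submonoid.Operations
import Mathlib.Algebra.Group.Pi.Lemmas
import Mathlib.Algebra.Group.Equiv.Basic
import Mathlib.Algebra.Module.NatInt
import Mathlib.Tactic.Ring
import HarnessLib

/-!
# [IUTchII] Corollaries 4.5–4.8: monoids and global realified Gaussian Frobenioids associated to
# (base-)`Θ^{±ell}`- and `ΘNF`-Hodge theaters; Remark 4.5.4 (the weighted diagonal)

S. Mochizuki, *Inter-universal Teichmüller theory II*, §4, Corollary 4.5 (i)–(v) (kurims Dec-2020
manuscript pp. 131–134), Remarks 4.5.1–4.5.4 (pp. 134–136), Corollary 4.6 (i)–(v) (pp. 137–139),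
Remarks 4.6.1–4.6.2 (pp. 139–140), Corollary 4.7 (i)–(iii) (pp. 140–142), Remarks 4.7.1–4.7.2,
Corollary 4.8 (i)–(iii) (pp. 149–151), Remarks 4.8.1–4.8.3 (pp. 151–153)
[cite: Mochizuki2012, Cor 4.5 p.131]. Claim key DISPUTED (D-0012): definitions, interfaces and
Prop-valued statements only; nothing asserted.

**What is printed (the concrete kernel).** Cor 4.5 (v) p. 133–134: the global realified Gaussian
Frobenioid `D^⊩_gau(†D^⊢_≻) ⊆ ∏_{j ∈ F_l^⋇} D^⊩(†D^⊢_≻)_j` "whose divisor and rational function monoids are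
determined … by the «vector of ratios» `(…, j²·, …)`", together with "a global formal evaluation
isomorphism of Frobenioids `D^⊩_env(†D^⊢_≻) ⥲ D^⊩_gau(†D^⊢_≻)` which is compatible … with the local
evaluation isomorphisms of (iv)" (`D^⊩_env` being "a copy of the Frobenioid `D^⊩(†D^⊢_≻)` … multiplied
by a formal symbol `log^{†D^⊢_≻}(Θ)`"); Remark 4.5.4 p. 136: "`D^⊩_gau(†D^⊢_≻)` may be thought of as a
sort of «weighted diagonal» … the divisor monoid (respectively, rational function monoid) of this
Frobenioid consists of elements of the form `(1²·φ, 2²·φ, …, j²·φ, …)` (respectively,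
`(1²·β, 2²·β, …, j²·β, …)`)". This is typed and PROVED over an abstract divisor monoid `Φ` (additive):
`weightedDiagonalHom`, its range `weightedDiagonal`, injectivity for `l⋇ ≥ 1`, the global formal
evaluation isomorphism `Φ ≃+ weightedDiagonal` (`globalEvalIso`), and the compatibility with the
local weights `j²·log(p_v)` of Prop 4.1 (iv) (`weightedDiagonalHom_local`).

**The assembly statements** (Cor 4.5 (i)–(iv), 4.6 (i)–(v), 4.7 (i)–(iii), 4.8 (i)–(iii) and
the Remarks): "functorial algorithms" in a `D`- or `F`-prime-strip, a `D`-`Θ^{±ell}`-, `Θ^{±ell}`-,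
`D`-`ΘNF`- or `ΘNF`-Hodge theater producing `V`-indexed assignments `v ↦ Ψ_cns(‡D)_v`, `Ψ^ss_cns(‡D^⊢)_v`,
`Ψ_env(†D_≻)_v`, `Ψ_gau(†D_≻)_v`, the global realified Frobenioids `D^⊩(‡D^⊢)`, `D^⊩_env`, `D^⊩_gau`,
`C^⊩_env(†HT^Θ)`, `C^⊩_gau(†HT^Θ)`, the `F_l^⋊±`- and `F_l^⋇`-symmetrizing isomorphisms, localization
functors and Kummer isomorphisms on the number-field side (`M^⊛_mod`, `F^⊛_mod`, …). Their inputs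
([IUTchI] §4–§6 Hodge theaters, bridges, prime-strips; the local items of this paper's
Props 3.1–4.4) are not in the tree: they are recorded as Prop-valued fields of interface
structures quoting print, one field per printed sub-item (`Cor45Statements`, `Cor46Statements`,
`Cor47Statements`, `Cor48Statements`). -- TODO-merge: abc-iut-L5-t3 ([IUTchI] §4), abc-iut-L5-t4
-- (§5–§6), abc-iut-L5-t2 (Ex 3.5 `C^⊩_mod`), this seat's local files (Props 3.x/4.x).
-/

namespace Literature.IUT.HodgeArakelov

open scoped NNReal

universe u v

/-! ### 1. Remark 4.5.4 / Corollary 4.5 (v): the weighted diagonal and the global formal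
evaluation isomorphism -/

section WeightedDiagonal

variable (Φ : Type u) [AddCommMonoid Φ] (lstar : ℕ)

/-- The weight `j²` attached to the label with natural number `j = i+1`, `i : Fin lstar` ("the
«vector of ratios» `(…, j²·, …)`", Cor 4.5 (v) p. 134). [cite: Mochizuki2012, Cor 4.5 (v) p.134] -/
def sqWeight (i : Fin lstar) : ℕ := (i.val + 1) ^ 2

/-- The **weighted diagonal map** `φ ↦ (1²·φ, 2²·φ, …, j²·φ, …)` on the divisor (or rational
function) monoid `Φ` of `D^⊩(†D^⊢_≻)` ([IUTchII] Remark 4.5.4 p. 136; Cor 4.5 (v) p. 133–134).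
[cite: Mochizuki2012, Rmk 4.5.4 p.136] -/
def weightedDiagonalHom : Φ →+ (Fin lstar → Φ) where
  toFun φ := fun i => sqWeight lstar i • φ
  map_zero' := by funext i; simp
  map_add' φ ψ := by funext i; simp [smul_add]

/-- The divisor monoid of `D^⊩_gau(†D^⊢_≻) ⊆ ∏_{j ∈ F_l^⋇} D^⊩(†D^⊢_≻)_j`: "elements of the form
`(1²·φ, 2²·φ, …, j²·φ, …)`" ([IUTchII] Remark 4.5.4 p. 136). [cite: Mochizuki2012, Rmk 4.5.4 p.136] -/
def weightedDiagonal : AddSubmonoid (Fin lstar → Φ) := AddMonoidHom.mrange (weightedDiagonalHom Φ lstar)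

/-- Membership: the printed shape. [cite: Mochizuki2012, Rmk 4.5.4 p.136] -/
theorem mem_weightedDiagonal_iff (x : Fin lstar → Φ) :
    x ∈ weightedDiagonal Φ lstar ↔ ∃ φ : Φ, ∀ i : Fin lstar, x i = ((i.val + 1) ^ 2 : ℕ) • φ := by
  unfold weightedDiagonal
  rw [AddMonoidHom.mem_mrange]
  constructor
  · rintro ⟨φ, rfl⟩; exact ⟨φ, fun i => rfl⟩
  · rintro ⟨φ, h⟩; exact ⟨φ, funext fun i => (h i).symm⟩

/-- The first component carries weight `1² = 1`, so the weighted diagonal map is injective for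
`l⋇ ≥ 1` (cf. Remark 4.10.3 (iii): the label `j = 1` "may be naturally identified with the
identity"). [cite: Mochizuki2012, Cor 4.5 (v) p.134] -/
theorem weightedDiagonalHom_injective (hl : 0 < lstar) :
    Function.Injective (weightedDiagonalHom Φ lstar) := by
  intro φ ψ h
  have := congrFun h ⟨0, hl⟩
  simpa [weightedDiagonalHom, sqWeight] using this

/-- The **global formal evaluation isomorphism** `D^⊩_env(†D^⊢_≻) ⥲ D^⊩_gau(†D^⊢_≻)` at the level of
divisor monoids: `Φ` (the divisor monoid of the copy `D^⊩_env = D^⊩ · log(Θ)`) maps isomorphically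
onto the weighted diagonal ([IUTchII] Cor 4.5 (v) p. 134), for `l⋇ ≥ 1`.
[cite: Mochizuki2012, Cor 4.5 (v) p.134] -/
noncomputable def globalEvalIso (hl : 0 < lstar) : Φ ≃+ weightedDiagonal Φ lstar :=
  AddEquiv.ofBijective (weightedDiagonalHom Φ lstar).mrangeRestrict
    ⟨fun _ _ h => weightedDiagonalHom_injective Φ lstar hl (congrArg Subtype.val h),
     AddMonoidHom.mrangeRestrict_surjective _⟩

/-- Compatibility of the global evaluation isomorphism with the local ones (Cor 4.5 (v):
"compatible, relative to the bijections and local isomorphisms of topological monoids …, with the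
local evaluation isomorphisms of (iv)"): if `ρ_v : Φ → ℝ≥0` is the local component at `v` (additive),
the `j`-component of the weighted diagonal of `φ` has local component `j² · ρ_v(φ)` — the weight of
Prop 4.1 (iv) with `log(p_v)·(coefficient) = ρ_v(φ)`. [cite: Mochizuki2012, Cor 4.5 (v) p.134] -/
theorem weightedDiagonalHom_local {V : Type v} (ρ : Φ →+ (V → ℝ≥0)) (φ : Φ) (i : Fin lstar) (v : V) :
    ρ (weightedDiagonalHom Φ lstar φ i) v = ((i.val + 1) ^ 2 : ℕ) * ρ φ v := by
  simp [weightedDiagonalHom, sqWeight, map_nsmul, nsmul_eq_mul]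

end WeightedDiagonal

/-! ### 2. Corollary 4.5: group-theoretic monoids of base-`Θ^{±ell}`-Hodge theaters (pp. 131–134) -/

/-- INTERFACE, [IUTchII] Corollary 4.5 (i)–(v) pp. 131–134, for a `D`-`Θ^{±ell}`-Hodge theater
`†HT^{D-Θ^{±ell}}` and a `D`-prime-strip `‡D = {‡D_v}_{v ∈ V}` (with `‡D_v = B^temp(‡Π_v)^0` at `v ∈ V^non`).
One Prop-valued field per printed sub-item, quoting print; none asserted.
[cite: Mochizuki2012, Cor 4.5 p.131] -/
structure Cor45Statements where
  /-- (i) p. 131 (Constant monoids): "a functorial algorithm in the `D`-prime-strip `‡D` for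
  constructing the assignment `Ψ_cns(‡D)`: `V^non ∋ v ↦ {G_v(‡Π_v) ↷ Ψ_cns(‡Π_v)}`,
  `V^arc ∋ v ↦ Ψ_cns(‡D_v)` — where the data in brackets … well-defined only up to a `‡Π_v`-conjugacy
  indeterminacy" (Props 3.1 (ii), 4.1 (i), 4.3 (i); Rmk 4.2.1 (i)). -/
  constantMonoids : Prop
  /-- (ii) p. 131–132 (Mono-analytic semi-simplifications): "a functorial algorithm in the
  `D^⊢`-prime-strip `‡D^⊢` for constructing `Ψ^ss_cns(‡D^⊢)`", each "equipped with a splitting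
  `Ψ^ss_cns(‡D^⊢)_v = Ψ^ss_cns(‡D^⊢)^×_v × ℝ_{≥0}(‡D^⊢)_v`" and "a distinguished element
  `log^{‡D^⊢}(p_v) ∈ ℝ_{≥0}(‡D^⊢)_v`"; isomorphisms `Ψ_cns(‡D)^×_v ⥲ Ψ^ss_cns(‡D^⊢)^×_v`; "a Frobenioid
  `D^⊩(‡D^⊢)` … isomorphic to … `C^⊩_mod` … equipped with a bijection `Prime(D^⊩(‡D^⊢)) ⥲ V`" and
  isomorphisms `‡ρ_{D^⊩,v} : Φ_{D^⊩(‡D^⊢),v} ⥲ ℝ_{≥0}(‡D^⊢)_v`. -/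
  semiSimplifications : Prop
  /-- (iii) p. 132–133 (Labels, `F_l^⋊±`-symmetries, conjugate synchronization): the bijection
  `†ζ_≻ : LabCusp^±(†D_≻) ⥲ T`; "the various local `F_l^⋊±`-actions … induce isomorphisms between the
  labeled data `Ψ_cns(†D_≻)_t` for distinct `t`", "compatible, relative to `†ζ_≻`, with the
  `F_l^⋊±`-symmetry of the associated `D`-`Θ^{ell}`-bridge", determining diagonal submonoids
  `Ψ_cns(†D_≻)_{⟨|F_l|⟩}`, `Ψ_cns(†D_≻)_{⟨F_l^⋇⟩}` and "an isomorphism `Ψ_cns(†D_≻)_0 ⥲ Ψ_cns(†D_≻)_{⟨F_l^⋇⟩}`". -/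
  symmetrizing : Prop
  /-- (iv) p. 133 (Local theta and Gaussian monoids): "a functorial algorithm in the `D`-prime-strip
  `†D_≻` for constructing assignments `Ψ_env(†D_≻)`, `Ψ_gau(†D_≻)`, `∞Ψ_env(†D_≻)`, `∞Ψ_gau(†D_≻)`",
  `V ∋ v ↦ Ψ_env(†D_{≻,v})` etc., "as well as compatible evaluation isomorphisms
  `Ψ_env(†D_≻) ⥲ Ψ_gau(†D_≻)`; `∞Ψ_env(†D_≻) ⥲ ∞Ψ_gau(†D_≻)`" (Cor 3.5 (ii),(iii); Props 4.1 (iv), 4.3 (iv)). -/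
  localThetaGaussian : Prop
  /-- (v) p. 133–134 (Global realified theta and Gaussian Frobenioids): `D^⊩_env(†D^⊢_≻)` "a copy of …
  `D^⊩(†D^⊢_≻)` … multiplied by a formal symbol `log^{†D^⊢_≻}(Θ)`", with `Prime ⥲ V` and
  `Φ_{D^⊩_env,v} ⥲ Ψ_env(†D^⊢_≻)^R_v`; `D^⊩_gau(†D^⊢_≻) ⊆ ∏_{j ∈ F_l^⋇} D^⊩(†D^⊢_≻)_j` by the vector of ratios
  `(…, j²·, …)` (= `weightedDiagonal`), with `Φ_{D^⊩_gau,v} ⥲ Ψ_gau(†D^⊢_≻)^R_v`; and the "global formal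
  evaluation isomorphism `D^⊩_env ⥲ D^⊩_gau` … compatible … with the local evaluation isomorphisms
  of (iv)" (= `globalEvalIso`, `weightedDiagonalHom_local`). -/
  globalRealified : Prop

/-- Remarks 4.5.1–4.5.3 (pp. 134–136) as recorded statements: 4.5.1 (i) the monoids of Cor 4.5
(i), (iv) "give rise to an `F`-prime-strip [resp. a well-defined `F^⊢`-prime-strip — up to an
indeterminacy, at the `v ∈ V^bad` …, relative to automorphisms of the split Frobenioid … that induce
the identity … on the subcategory of isometries]"; the Frobenioid-theoretic formulation "is
technically ill-suited to discussions of conjugate synchronization"; 4.5.1 (ii) no such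
complications for realifications; 4.5.2 (i),(ii) labeled / multi-basepoint versions of the
symmetrizing isomorphisms "We leave the routine details to the reader"; 4.5.3 (i)–(iii) the
significance of the `F_l^⋊±`-symmetry (conjugate synchronization "is possible in the case of the
`F_l^⋊±`-symmetry — but not in the case of the `F_l^⋇`-symmetry"; the global `†D^{⊚±}` "synchroniz[es]
the `±`-indeterminacies at each `v ∈ V`"). Expository; Prop slots. [cite: Mochizuki2012, Rmk 4.5.3 p.135] -/
structure Remark45Statements where
  /-- 4.5.1 (i): `F`- and `F^⊢`-prime-strips from the monoids, up to the stated indeterminacy -/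
  primeStripsFromMonoids : Prop
  /-- 4.5.2: labeled and multi-basepoint symmetrizing isomorphisms -/
  labeledVersions : Prop
  /-- 4.5.3 (iii): gluing the local `F_l^⋊±`-symmetries requires the global portion `†D^{⊚±}` -/
  globalSynchronization : Prop

/-! ### 3. Corollary 4.6: Frobenioid-theoretic monoids of `Θ^{±ell}`-Hodge theaters (pp. 137–139) -/

/-- INTERFACE, [IUTchII] Corollary 4.6 (i)–(v) pp. 137–139, for a `Θ^{±ell}`-Hodge theater
`†HT^{Θ^{±ell}}` over `†HT^{D-Θ^{±ell}}`, an `F`-prime-strip `‡F` over `‡D`, and (for (iv),(v)) a Θ-bridge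
`†F_J → †F_> ⇢ †HT^Θ` glued to the `Θ^±`-bridge via [IUTchI] Prop 6.7 (`J = T^⋇`). One Prop-valued field
per printed sub-item; none asserted. [cite: Mochizuki2012, Cor 4.6 p.137] -/
structure Cor46Statements where
  /-- (i) p. 137 (Constant monoids): "a functorial algorithm in the `F`-prime-strip `‡F` for
  constructing the assignment `Ψ_cns(‡F)`: `V^non ∋ v ↦ {G_v(‡Π_v) ↷ Ψ_{‡F_v}}`, `V^arc ∋ v ↦ Ψ_{‡F_v}`"
  and the collection of Kummer isomorphisms `Ψ_cns(‡F) ⥲ Ψ_cns(‡D)` (Props 3.3 (ii), 4.2 (i), 4.4 (i)). -/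
  constantMonoids : Prop
  /-- (ii) p. 137–138 (Mono-analytic semi-simplifications): `Ψ^ss_cns(‡F^⊢)`, `V ∋ v ↦ Ψ^ss_{‡F^⊢_v}` with
  splittings and distinguished elements; `Ψ^ss_cns(‡F^⊢) ⥲ Ψ^ss_cns(‡D^⊢)`; for the `F^⊩`-prime-strip
  `‡F^⊩ = (‡C^⊩, Prime(‡C^⊩) ⥲ V, ‡F^⊢, {‡ρ_v})` "an isomorphism of Frobenioids `‡C^⊩ ⥲ D^⊩(‡D^⊢)` that is
  uniquely determined by the condition that it be compatible with the respective bijections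
  `Prime(−) ⥲ V` and local isomorphisms", and "a functorial algorithm for constructing [it] from the
  `F^⊩`-prime-strip `‡F^⊩`". -/
  semiSimplifications : Prop
  /-- (iii) p. 138 (Labels, `F_l^⋊±`-symmetries, conjugate synchronization): compatible isomorphisms
  `Ψ_cns(†F_≻)_t ⥲ Ψ_cns(†D_≻)_t` with `†Π_v`-conjugacy indeterminacy "independent of `t`",
  `F_l^⋊±`-symmetrizing isomorphisms compatible with the `D`-`Θ^{ell}`-bridge symmetry, and "an
  isomorphism `Ψ_cns(†F_≻)_0 ⥲ Ψ_cns(†F_≻)_{⟨F_l^⋇⟩}`". -/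
  symmetrizing : Prop
  /-- (iv) p. 138–139 (Local theta and Gaussian monoids): "a functorial algorithm in the Θ-bridge …
  for constructing assignments `Ψ_{F_env}(†HT^Θ)`, `Ψ_{F_gau}(†HT^Θ)`, `∞Ψ_{F_env}(†HT^Θ)`, `∞Ψ_{F_gau}(†HT^Θ)`",
  `V ∋ v ↦ Ψ_{†F^Θ_v}`, `Ψ_{F_gau}(†F_v)`, …, "as well as compatible evaluation isomorphisms
  `Ψ_{F_env}(†HT^Θ) ⥲ Ψ_env(†D_>) ⥲ Ψ_gau(†D_>) ⥲ Ψ_{F_gau}(†HT^Θ)`" and their `∞`-versions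
  (Cor 3.6 (ii); Props 4.2 (iv), 4.4 (iv)). -/
  localThetaGaussian : Prop
  /-- (v) p. 139 (Global realified theta and Gaussian Frobenioids): "Frobenioids `C^⊩_env(†HT^Θ)`,
  `C^⊩_gau(†HT^Θ)`" with `Prime ⥲ V`, local isomorphisms `Φ_{C^⊩_env,v} ⥲ Ψ_{F_env}(†HT^Θ)^R_v`,
  `Φ_{C^⊩_gau,v} ⥲ Ψ_{F_gau}(†HT^Θ)^R_v`, and "evaluation isomorphisms
  `C^⊩_env(†HT^Θ) ⥲ D^⊩_env(†D^⊢_>) ⥲ D^⊩_gau(†D^⊢_>) ⥲ C^⊩_gau(†HT^Θ)`" obtained "by «conjugating» the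
  evaluation isomorphism of Corollary 4.5, (v), by the isomorphism `‡C^⊩ ⥲ D^⊩(‡D^⊢)` of (ii)",
  compatible with the local evaluation isomorphisms of (iv). -/
  globalRealified : Prop

/-- Remark 4.6.1 (p. 139–140): at `v ∈ V^non` the poly-isomorphism `Ψ^ss_{†F^⊢_v} ⥲ Ψ^ss_cns(†G_v)` "may
be reconstructed algorithmically from `†F^⊢_v`", whereas at `v ∈ V^arc` "it is not possible to
reconstruct algorithmically [the non-unit portion]" (the distinguished element "is not preserved
by arbitrary automorphisms of `†F^⊢_v`"); with the global Frobenioids as "devices for currency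
exchange" the archimedean distinguished elements "may be computed … from the distinguished
elements at `v ∈ V^non`". Remark 4.6.2: observations of 4.5.1 (i), 4.5.2 apply to Cor 4.6.
Prop slots. [cite: Mochizuki2012, Rmk 4.6.1 p.139] -/
structure Remark46Statements where
  /-- nonarchimedean reconstructibility of `Ψ^ss_{†F^⊢_v} ⥲ Ψ^ss_cns(†G_v)` -/
  nonarchReconstructible : Prop
  /-- archimedean non-reconstructibility of the distinguished element from `†F^⊢_v` alone -/
  archNotReconstructible : Prop
  /-- "currency exchange": archimedean distinguished elements from the nonarchimedean ones -/
  currencyExchange : Prop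

/-! ### 4. Corollaries 4.7, 4.8: base-`ΘNF`- and `ΘNF`-Hodge theaters (pp. 140–142, 149–151) -/

/-- INTERFACE, [IUTchII] Corollary 4.7 (i)–(iii) pp. 140–142, for a `D`-`ΘNF`-Hodge theater
`†HT^{D-ΘNF} = (†D^⊚ ← †D_J → †D_>)` glued to `†HT^{D-Θ^{±ell}}` via [IUTchI] Prop 6.7. One Prop-valued
field per printed sub-item; none asserted. [cite: Mochizuki2012, Cor 4.7 p.140] -/
structure Cor47Statements where
  /-- (i) p. 140–141 (Non-realified global structures): "a functorial algorithm in the category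
  `†D^⊚` for constructing the morphism `†D^⊚ → †D^⊛`", the monoid/field/pseudo-monoid
  `π₁(†D^⊛) ↷ M^⊛(†D^⊚)`, `π₁(†D^⊛) ↷ M̄^⊛(†D^⊚)`, `π₁^{κ-sol}(†D^⊛) ↷ M^⊛_{∞κ}(†D^⊚)` "well-defined up to …
  conjugacy indeterminacies", the invariants `M^⊛_mod ⊆ M^⊛_sol ⊆ M^⊛`, `M̄^⊛_mod ⊆ M̄^⊛`, `M^⊛_κ ⊆ M^⊛_{∞κ}`,
  the Frobenioids `F^⊛_mod(†D^⊚) ⊆ F^⊛(†D^⊚) ← F^⊚(†D^⊚)` with `Prime(F^⊛_mod(†D^⊚)) ⥲ V`, and the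
  realification functor `F^⊛_mod(†D^⊚) → F^{⊛ℝ}_mod(†D^⊚)`. -/
  nonRealifiedGlobal : Prop
  /-- (ii) p. 141–142 (Labels and `F_l^⋇`-symmetry): the bijection `†ζ_⋇ : LabCusp(†D^⊚) ⥲ J (⥲ F_l^⋇)`;
  "a functorial algorithm … for constructing an `F`-prime-strip `F^⊚(†D^⊚)|_j`"; the `F_l^⋇`-symmetrizing
  isomorphisms between the labeled data `F^⊚(†D^⊚)|_j, M^⊛_mod(†D^⊚)_j, …` for distinct `j`, subject to
  "independent `π₁^{rat/κ-sol}(†D^⊚)`-conjugacy indeterminacies for distinct `j`, together with a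
  single … indeterminacy that is independent of `j`", compatible with the `F_l^⋇`-symmetry of the
  `D`-NF-bridge, determining "diagonal `F`-prime-strips/submonoids/subrings/sub-pseudo-monoids
  /subcategories `(−)_{⟨F_l^⋇⟩} ⊆ ∏_{j ∈ F_l^⋇} (−)_j`" ("in a purely formal sense"). -/
  labelsSymmetry : Prop
  /-- (iii) p. 142 (Localization functors and realified global structures): "[1-]compatible
  collections of «localization» functors/poly-morphisms `F^⊛_mod(†D^⊚)_j → F^⊚(†D^⊚)|_j`,
  `F^{⊛ℝ}_mod(†D^⊚)_j → (F^⊚(†D^⊚)|_j)^ℝ`, `{π₁^{κ-sol}(†D^⊛) ↷ M^⊛_{∞κ}(†D^⊚)}_j → M_{∞κv}(†D_{v_j}) ⊆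
  M_{∞κ×v}(†D_{v_j})`", "a natural isomorphism of Frobenioids `D^⊩(†D^⊢_j) ⥲ F^{⊛ℝ}_mod(†D^⊚)_j`" and, for
  each `v`, "a natural isomorphism of topological monoids `ℝ_{≥0}(†D^⊢_j)_v ⥲ Ψ_{(F^⊚(†D^⊚)|_j)^ℝ,v}`",
  all compatible with the `F_l^⋇`-symmetrizing isomorphisms. -/
  localization : Prop

/-- INTERFACE, [IUTchII] Corollary 4.8 (i)–(iii) pp. 149–151, for a `ΘNF`-Hodge theater
`†HT^{ΘNF} = (†F^⊛ ⇠ †F^⊚ ← †F_J → †F_> ⇢ †HT^Θ)` lifting `†HT^{D-ΘNF}` and glued to `†HT^{Θ^{±ell}}`. One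
Prop-valued field per printed sub-item; none asserted. [cite: Mochizuki2012, Cor 4.8 p.149] -/
structure Cor48Statements where
  /-- (i) p. 150 (Non-realified global structures): "Kummer isomorphisms of pseudo-monoids
  `{π₁^{κ-sol}(†D^⊛) ↷ †M^⊛_{∞κ}} ⥲ {π₁^{κ-sol}(†D^⊛) ↷ M^⊛_{∞κ}(†D^⊚)}`, `†M^⊛_κ ⥲ M^⊛_κ(†D^⊚)`" and, by
  restricting Kummer classes, `{π₁(†D^⊛) ↷ †M^⊛} ⥲ {π₁(†D^⊛) ↷ M^⊛(†D^⊚)}`, …, `†M^⊛_mod ⥲ M^⊛_mod(†D^⊚)`,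
  `†M̄^⊛_mod ⥲ M̄^⊛_mod(†D^⊚)`, "interpreted as a compatible collection of isomorphisms of Frobenioids
  `†F^⊚ ⥲ F^⊚(†D^⊚)`, `†F^⊛ ⥲ F^⊛(†D^⊚)`, `†F^⊛_mod ⥲ F^⊛_mod(†D^⊚)`, `†F^{⊛ℝ}_mod ⥲ F^{⊛ℝ}_mod(†D^⊚)`". -/
  kummerGlobal : Prop
  /-- (ii) p. 150–151 (Labels and `F_l^⋇`-symmetry): for each `j ∈ LabCusp(†D^⊚)`, isomorphisms
  `†F_j ⥲ †F^⊚|_j ⥲ F^⊚(†D^⊚)|_j`, `(†M^⊛_mod)_j ⥲ M^⊛_mod(†D^⊚)_j`, …, `(†F^{⊛ℝ}_mod)_j ⥲ F^{⊛ℝ}_mod(†D^⊚)_j`,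
  and `F_l^⋇`-symmetrizing isomorphisms "induced by the natural poly-action of `F_l^⋇` on `†F^⊚`",
  with the same pattern of conjugacy indeterminacies as Cor 4.7 (ii), compatible with the NF-bridge,
  determining diagonal objects `(−)_{⟨F_l^⋇⟩} ⊆ ∏_{j ∈ F_l^⋇} (−)_j`. -/
  labelsSymmetry : Prop
  /-- (iii) p. 151 (Localization functors and realified global structures): "mutually
  [1-]compatible collections of «localization» functors/poly-morphisms `(†F^⊛_mod)_j → †F_j`,
  `(†F^{⊛ℝ}_mod)_j → †F^ℝ_j`, `{π₁^{κ-sol}(†D^⊛) ↷ †M^⊛_{∞κ}}_j → †M_{∞κv_j} ⊆ †M_{∞κ×v_j}`", compatible with the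
  Kummer isomorphisms of (i), (ii) and Cor 4.7 (iii), "a natural isomorphism of Frobenioids
  `†C^⊩_j ⥲ (†F^{⊛ℝ}_mod)_j`" compatible with `Prime(−)`, local isomorphisms, Cor 4.7 (iii), Cor 4.6
  (ii); "all of these structures are compatible with the respective `F_l^⋇`-symmetrizing
  isomorphisms". -/
  localization : Prop

/-- Remarks 4.7.1, 4.7.2, 4.7.6, 4.8.1–4.8.3 (pp. 143, 148–149, 151–153) as recorded statements:
4.7.2 — for the `F_l^⋇`-symmetry "it is not possible to establish … conjugate synchronization" since
it "arises from conjugation by elements with nontrivial image in the arithmetic portion", whence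
(a) `F`-prime-strips and (b) the `mod/sol/κ-sol/∞κ` objects; 4.7.6 — "it makes sense to consider
non-realified global Frobenioids … only in the case of the `F_l^⋇`-symmetry" (one cannot quotient
by the `F_l^⋇`-indeterminacy without "label-crushing"); 4.8.1 (i)–(iii) — `C^⊩_gau(†HT^Θ) ↪
∏_{j ∈ F_l^⋇} (†F^{⊛ℝ}_mod)_j`, `F_gau(†HT^Θ)^ℝ ↪ ∏_j (†F^ℝ_>)_j ⥲ ∏_j †F^ℝ_j` via the full
poly-isomorphisms `(†F_>)_j ⥲ †F_j`, and the induced "realified localization" functor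
`C^⊩_gau(†HT^Θ) → F_gau(†HT^Θ)^ℝ` compatible with `Φ_{C^⊩_gau,v} ⥲ Ψ_{F_gau}(†HT^Θ)^R_v`; 4.8.2 (i)–(iii)
— the unit portion is used additively via `log` in [IUTchIII], the value-group portion
multiplicatively, a construction that "depends, in an essential way, … on the natural splittings";
4.8.3 — analogue of 4.5.2. Prop slots; expository parts not typed. [cite: Mochizuki2012, Rmk 4.8.1 p.151] -/
structure Remark4748Statements where
  /-- 4.7.2: `F_l^⋇`-symmetry incompatible with conjugate synchronization -/
  noConjSyncForFlStar : Prop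
  /-- 4.7.6: non-realified global Frobenioids only under the `F_l^⋇`-symmetry -/
  nonRealifiedOnlyFlStar : Prop
  /-- 4.8.1 (iii): the realified localization functor `C^⊩_gau(†HT^Θ) → F_gau(†HT^Θ)^ℝ` -/
  realifiedLocalization : Prop
  /-- 4.8.2 (i): log-shifted units together with non-log-shifted value groups -/
  logShiftedUnits : Prop

end Literature.IUT.HodgeArakelov
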